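import Mathlib
import Summits.NavierStokesRegularity.NavierStokesRegularity.Theorems.HeteroclinicTriggerChainTriggerChainFrontStepTruncIgnition
import Summits.NavierStokesRegularity.NavierStokesRegularity.Theorems.HeteroclinicTriggerChainTriggerChainFrontStepTruncHop
import HarnessLib

/-!
# `HeteroclinicTriggerChain` — crux `TriggerChainFrontStep` (item stmt-NavierStokesRegularity-22785):
  the FULL HOP of the seeded two-shell truncation — delay → ignition → capture, with the seed handed over

Blueprint item 2 (hop map) of the lead prover's card `Cruxes/TriggerChainFrontStep/Lines/gapdata_v2.md`,
END-TO-END on the seeded two-shell truncation of the pinned table with complete-transfer tuning `g = e`: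
`x′ = −eu² − βuv`, `u′ = exu − euy`, `y′ = eu² − e′v²`, `v′ = βxu + e′yv` (energy conserved).
`heteroclinicTriggerChain_trunc_fullHop` composes the delay phase / ignition lemma
(`heteroclinicTriggerChain_trunc_ignition_exists`, tree file `…TruncIgnition`) with the post-ignition
capture lemma of the sibling seat (`heteroclinicTriggerChain_trunc_hop_capture`, tree file `…TruncHop`),
by a time shift at the ignition time (the system is autonomous): from a restart-type state (energy `≤ 1`,
seed `0 < u(0) < h`, residues `y(0), v(0) ≥ 0`) there are an IGNITION TIME `T_h` and a first CAPTURE TIME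
`T_c`, `0 < T_h ≤ T_c ≤ T_h + T`, with
* timing `log(h/u(0))/e ≤ T_h ≤ log(h/u(0))/(e(1−ε))`, `ε = δ₁ + δ₂` (delay), `T_c − T_h ≤ T` (transfer);
* `u(T_h) = h`, `u < h` on `[0, T_h)`; `x(T_c) − y(T_c) = −L`, `x − y > −L` on `[T_h, T_c)`;
* receiver content at capture `2y(T_c) ≥ 1 − δ₁ + y(0) + L − φ(T_c − T_h)`;
* upper trigger under control through the transfer, `|v| ≤ V` on `[T_h, T_h + T]`, and the SEED HANDED
  OVER bounded below INDEPENDENTLY of the incoming seed `u(0)`: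
  `v(T_c) ≥ (v(0) + β(1−δ₁)(h − u(0))/e) · e^{−(e′V)²T·T}` (the regenerated seed `≍ βh/e` survives the
  transfer; `W = v·e^{−∫e′y}` is non-decreasing while the carrier is nonnegative, and `y ≥ −e′V²T` there).
Tools: `htcTP_first_hit` (first hitting time of a level from above, by `sInf`), `htcTP_upper_lower_bound`
(`v ≥ v(0)e^{−e′ȳs}` while `βxu ≥ 0`, `y ≥ −ȳ`), `htcTP_gronwallBound_mono`.

HONEST FRAMING: elementary real analysis of a four-dimensional quadratic ODE (a MODEL truncation of Tao's
lattice, Tao 2016 §4); helper for the crux (no stub credit); the lattice remainders (junk triads, tails, wake)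
are NOT treated here; nothing here is a statement about the Navier–Stokes equations; no summit, rung or crux
is proved. NS regularity is not proved by this line.
-/

noncomputable section

-- the sub-problem namespace `Summit.NavierStokesRegularity.NavierStokesRegularity` repeats the summit name by design (D-0017)
set_option linter.dupNamespace false

open Real Set

namespace Summit.NavierStokesRegularity.NavierStokesRegularity.Theorems

/-- **First hitting time of a level from above.** If `f` is continuous, `f(0) > c` and `f(t₀) ≤ c` for
some `t₀ ≥ 0`, then there is a first time `0 < τ ≤ t₀` with `f(τ) = c` and `f > c` on `[0, τ)`. [folklore] -/
theorem htcTP_first_hit {f : ℝ → ℝ} (hf : Continuous f) {c t₀ : ℝ} (h0 : c < f 0) (ht₀ : 0 ≤ t₀)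
    (hhit : f t₀ ≤ c) : ∃ τ, 0 < τ ∧ τ ≤ t₀ ∧ f τ = c ∧ ∀ s ∈ Ico 0 τ, c < f s := by
  set S : Set ℝ := Icc 0 t₀ ∩ f ⁻¹' Iic c with hS
  have hSne : S.Nonempty := ⟨t₀, ⟨ht₀, le_rfl⟩, hhit⟩
  have hSbdd : BddBelow S := ⟨0, fun s hs => hs.1.1⟩
  have hSclosed : IsClosed S := isClosed_Icc.inter (isClosed_Iic.preimage hf)
  obtain ⟨⟨hτ0, hτt⟩, hτc⟩ : sInf S ∈ S := hSclosed.csInf_mem hSne hSbdd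
  set τ : ℝ := sInf S with hτ
  have hτc' : f τ ≤ c := hτc
  have hbefore : ∀ s ∈ Ico 0 τ, c < f s := by
    intro s hs
    by_contra hcon
    push Not at hcon
    have hmem : s ∈ S := ⟨⟨hs.1, hs.2.le.trans hτt⟩, hcon⟩
    exact absurd (csInf_le hSbdd hmem) (not_le.2 hs.2)
  have hτpos : 0 < τ := by
    rcases hτ0.eq_or_lt with h | h
    · exfalso
      rw [← h] at hτc'
      linarith
    · exact h
  refine ⟨τ, hτpos, hτt, le_antisymm hτc' ?_, hbefore⟩
  have hsub : Ico 0 τ ⊆ f ⁻¹' Ici c := fun s hs => (hbefore s hs).le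
  have hcl : closure (Ico 0 τ) ⊆ f ⁻¹' Ici c := (isClosed_Ici.preimage hf).closure_subset_iff.2 hsub
  have hτcl : τ ∈ closure (Ico 0 τ) := by
    rw [closure_Ico hτpos.ne]
    exact ⟨hτpos.le, le_rfl⟩
  exact hcl hτcl

/-- **The upper trigger does not lose its seed**: if `v′ = βxu + e′yv` with `βxu ≥ 0` and `y ≥ −ȳ`
(`e′ ≥ 0`) on `[0, t]` and `v(0) ≥ 0`, then `v(s) ≥ v(0) e^{−e′ȳ s}` on `[0, t]`
(`Z = v·e^{e′ȳs}` is non-decreasing). [folklore] -/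
theorem htcTP_upper_lower_bound {x u y v : ℝ → ℝ} {β e' ybar : ℝ} (he' : 0 ≤ e')
    (hv : ∀ s, HasDerivAt v (β * x s * u s + e' * y s * v s) s) (hyc : Continuous y)
    {t : ℝ} (hxu : ∀ s ∈ Icc 0 t, 0 ≤ β * x s * u s) (hy : ∀ s ∈ Icc 0 t, -ybar ≤ y s)
    (hv0 : 0 ≤ v 0) :
    ∀ s ∈ Icc 0 t, v 0 * Real.exp (-(e' * ybar * s)) ≤ v s := by
  have hvnn := htcTP_upper_nonneg hv hyc hxu hv0
  have hZ : ∀ s, HasDerivAt (fun q => v q * Real.exp (e' * ybar * q))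
      ((β * x s * u s + e' * y s * v s) * Real.exp (e' * ybar * s) +
        v s * (Real.exp (e' * ybar * s) * (e' * ybar))) s := by
    intro s
    have h1 : HasDerivAt (fun q => e' * ybar * q) (e' * ybar) s := by
      simpa using (hasDerivAt_id' s).const_mul (e' * ybar)
    exact (hv s).mul h1.exp
  have hZ' : ∀ s ∈ Icc 0 t, 0 ≤ (β * x s * u s + e' * y s * v s) * Real.exp (e' * ybar * s) +
      v s * (Real.exp (e' * ybar * s) * (e' * ybar)) := by
    intro s hs
    have h1 : (β * x s * u s + e' * y s * v s) * Real.exp (e' * ybar * s) +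
        v s * (Real.exp (e' * ybar * s) * (e' * ybar)) =
        (β * x s * u s + e' * (y s + ybar) * v s) * Real.exp (e' * ybar * s) := by ring
    rw [h1]
    have h2 : 0 ≤ y s + ybar := by linarith [hy s hs]
    have h3 := hxu s hs
    have h4 := hvnn s hs
    positivity
  have hZle := htcTP_le_of_deriv_nonneg hZ hZ'
  intro s hs
  have h1 := hZle s hs
  simp only [mul_zero, Real.exp_zero, mul_one] at h1
  have h2 : v 0 * Real.exp (-(e' * ybar * s)) ≤
      v s * Real.exp (e' * ybar * s) * Real.exp (-(e' * ybar * s)) :=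
    mul_le_mul_of_nonneg_right h1 (Real.exp_pos _).le
  have h3 : Real.exp (e' * ybar * s) * Real.exp (-(e' * ybar * s)) = 1 := by
    rw [← Real.exp_add, add_neg_cancel, Real.exp_zero]
  calc v 0 * Real.exp (-(e' * ybar * s)) ≤ v s * Real.exp (e' * ybar * s) * Real.exp (-(e' * ybar * s)) := h2
    _ = v s * (Real.exp (e' * ybar * s) * Real.exp (-(e' * ybar * s))) := by ring
    _ = v s := by rw [h3, mul_one]

/-- The Grönwall envelope `gronwallBound δ K ε x` is monotone in the initial size `δ` (for `x` arbitrary).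
[folklore] -/
theorem htcTP_gronwallBound_mono {δ₁ δ₂ K ε x : ℝ} (hδ : δ₁ ≤ δ₂) :
    gronwallBound δ₁ K ε x ≤ gronwallBound δ₂ K ε x := by
  by_cases hK : K = 0
  · subst hK
    rw [gronwallBound_K0, gronwallBound_K0]
    linarith
  · rw [gronwallBound_of_K_ne_0 hK, gronwallBound_of_K_ne_0 hK]
    simp only
    have h1 := mul_le_mul_of_nonneg_right hδ (Real.exp_pos (K * x)).le
    linarith

/-- **THE FULL HOP OF THE SEEDED TWO-SHELL TRUNCATION: delay → ignition → capture** (helper for item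
stmt-NavierStokesRegularity-22785; `g = e`, `e, e′ > 0`, `β ≥ 0`, energy `≤ 1`, `0 < u(0) < h`,
`y(0), v(0) ≥ 0`). DELAY CONSTANTS (as in `heteroclinicTriggerChain_trunc_delayPhase` with `g = e`):
`δ₂ ≥ y(0) + h²`, horizon `T_max` with `Λ ≥ e′δ₂T_max`, `V_d ≥ e^{2Λ}(v(0) + 2βh/e)`,
`δ₁ ≥ 1 − x(0) + h² + 2βV_d h/e`, `2δ₁ + 2δ₂ ≤ 1/2`, `4e′e^{4Λ}v(0)² ≤ e u(0)²`, `16e′β²e^{4Λ} ≤ e³`,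
`log(h/u(0))/(e(1 − (δ₁+δ₂))) < T_max`. TRANSFER CONSTANTS (as in
`heteroclinicTriggerChain_trunc_hop_capture` at the ignition state): window `T ≥ (1+L)/(2em − φ)`, upper
trigger ceiling `V ≥ gronwallBound V_d e′ β T`, forcing `φ = 2βV + e′V²` with `φ < 2em`, trigger energy
`2m + 12φT ≤ 2h²`, capture level `0 ≤ L`, `L² + 2m + 12φT ≤ (1 − δ₁ − δ₂)² + 2h²`, `L + δ₁ + φT ≤ 1`.
CONCLUSION: ignition time `T_h` and first capture time `T_c` with the properties listed in the module
docstring. [folklore] -/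
theorem heteroclinicTriggerChain_trunc_fullHop (e e' β : ℝ) (he : 0 < e) (he' : 0 < e') (hβ : 0 ≤ β)
    (x u y v : ℝ → ℝ)
    (hx : ∀ t, HasDerivAt x (-(e * u t ^ 2) - β * u t * v t) t)
    (hu : ∀ t, HasDerivAt u (e * x t * u t - e * u t * y t) t)
    (hy : ∀ t, HasDerivAt y (e * u t ^ 2 - e' * v t ^ 2) t)
    (hv : ∀ t, HasDerivAt v (β * x t * u t + e' * y t * v t) t)
    (hE : x 0 ^ 2 + u 0 ^ 2 + y 0 ^ 2 + v 0 ^ 2 ≤ 1)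
    (hu0 : 0 < u 0) (hy0 : 0 ≤ y 0) (hv0 : 0 ≤ v 0)
    {Tmax h Λ δ₁ δ₂ Vd T V φ m L : ℝ} (huh0 : u 0 < h)
    (hδ₂ : y 0 + h ^ 2 ≤ δ₂) (hΛT : e' * δ₂ * Tmax ≤ Λ)
    (hVd : Real.exp (2 * Λ) * (v 0 + 2 * β * h / e) ≤ Vd)
    (hδ₁ : 1 - x 0 + h ^ 2 + 2 * β * Vd * h / e ≤ δ₁)
    (hsmall : 2 * δ₁ + 2 * δ₂ ≤ 1 / 2)
    (hv0u0 : 4 * e' * Real.exp (4 * Λ) * v 0 ^ 2 ≤ e * u 0 ^ 2)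
    (hβe : 16 * e' * β ^ 2 * Real.exp (4 * Λ) ≤ e ^ 3)
    (hTmax : Real.log (h / u 0) / (e * (1 - (δ₁ + δ₂))) < Tmax)
    (hT : 0 ≤ T) (hV : gronwallBound Vd e' β T ≤ V) (hφ : φ = 2 * β * V + e' * V ^ 2)
    (hφm : φ < 2 * e * m) (hm : 2 * m + 12 * φ * T ≤ 2 * h ^ 2) (hL0 : 0 ≤ L)
    (hL : L ^ 2 + 2 * m + 12 * φ * T ≤ (1 - δ₁ - δ₂) ^ 2 + 2 * h ^ 2)
    (hL1 : L + δ₁ + φ * T ≤ 1) (hTT : (1 + L) / (2 * e * m - φ) ≤ T) :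
    ∃ Th Tc : ℝ, 0 < Th ∧ Th ≤ Tmax ∧ Th ≤ Tc ∧ Tc ≤ Th + T ∧
      u Th = h ∧ (∀ s ∈ Ico 0 Th, u s < h) ∧
      Real.log (h / u 0) / e ≤ Th ∧ Th ≤ Real.log (h / u 0) / (e * (1 - (δ₁ + δ₂))) ∧
      x Tc - y Tc = -L ∧ (∀ s ∈ Ico Th Tc, -L < x s - y s) ∧
      1 - δ₁ + y 0 + L - φ * (Tc - Th) ≤ 2 * y Tc ∧
      (∀ s ∈ Icc Th (Th + T), |v s| ≤ V) ∧
      (v 0 + β * (1 - δ₁) * (h - u 0) / e) * Real.exp (-((e' * V) ^ 2 * T * T)) ≤ v Tc := by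
  have hxc : Continuous x := continuous_iff_continuousAt.2 fun t => (hx t).continuousAt
  have huc : Continuous u := continuous_iff_continuousAt.2 fun t => (hu t).continuousAt
  have hyc : Continuous y := continuous_iff_continuousAt.2 fun t => (hy t).continuousAt
  have hhpos : 0 < h := hu0.trans huh0
  -- rewrite the delay hypotheses in the `g = e` instance of the general lemmas
  have hee : e * h ^ 2 / e = h ^ 2 := by field_simp
  have hδ₂' : y 0 + e * h ^ 2 / e ≤ δ₂ := by rw [hee]; exact hδ₂
  have heδ : e * δ₂ / e = δ₂ := by field_simp
  have hsmall' : 2 * δ₁ + 2 * e * δ₂ / e ≤ 1 / 2 := by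
    rw [show 2 * e * δ₂ / e = 2 * (e * δ₂ / e) by ring, heδ]; linarith
  have hβe' : 16 * e' * β ^ 2 * Real.exp (4 * Λ) ≤ e * e ^ 2 := by
    rw [show e * e ^ 2 = e ^ 3 by ring]; exact hβe
  have hTmax' : Real.log (h / u 0) / (e * (1 - (δ₁ + e * δ₂ / e))) < Tmax := by rw [heδ]; exact hTmax
  -- Step 1: ignition
  obtain ⟨Th, hTh0, hThmax, huTh, hbefore, hThlow, hThup, hxTh, hxTh1, hyTh0, hyTh, hvTh, hvTh'⟩ :=
    heteroclinicTriggerChain_trunc_ignition_exists e e e' β he he he'.le hβ x u y v hx hu hy hv hE hu0 hy0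
      hv0 huh0 hδ₂' hΛT hVd hδ₁ hsmall' hv0u0 hβe' hTmax'
  rw [heδ] at hThup
  -- Step 2: the shifted system at the ignition time
  set x₁ : ℝ → ℝ := fun s => x (s + Th) with hx₁
  set u₁ : ℝ → ℝ := fun s => u (s + Th) with hu₁
  set y₁ : ℝ → ℝ := fun s => y (s + Th) with hy₁
  set v₁ : ℝ → ℝ := fun s => v (s + Th) with hv₁
  have hx1 : ∀ t, HasDerivAt x₁ (-(e * u₁ t ^ 2) - β * u₁ t * v₁ t) t := fun t =>
    (hx (t + Th)).comp_add_const t Th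
  have hu1 : ∀ t, HasDerivAt u₁ (e * x₁ t * u₁ t - e * u₁ t * y₁ t) t := fun t =>
    (hu (t + Th)).comp_add_const t Th
  have hy1 : ∀ t, HasDerivAt y₁ (e * u₁ t ^ 2 - e' * v₁ t ^ 2) t := fun t =>
    (hy (t + Th)).comp_add_const t Th
  have hv1 : ∀ t, HasDerivAt v₁ (β * x₁ t * u₁ t + e' * y₁ t * v₁ t) t := fun t =>
    (hv (t + Th)).comp_add_const t Th
  have hEs : ∀ s, x s ^ 2 + u s ^ 2 + y s ^ 2 + v s ^ 2 ≤ 1 := fun s => by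
    rw [heteroclinicTriggerChain_trunc_energy e e e' β x u y v hx hu hy hv s]; exact hE
  have hE1 : x₁ 0 ^ 2 + u₁ 0 ^ 2 + y₁ 0 ^ 2 + v₁ 0 ^ 2 ≤ 1 := by
    simp only [hx₁, hu₁, hy₁, hv₁, zero_add]; exact hEs Th
  have hu10 : u₁ 0 = h := by simp only [hu₁, zero_add]; exact huTh
  have hx10 : x₁ 0 = x Th := by simp only [hx₁, zero_add]
  have hy10 : y₁ 0 = y Th := by simp only [hy₁, zero_add]
  have hv10 : v₁ 0 = v Th := by simp only [hv₁, zero_add]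
  -- sizes at ignition
  have hδ₂nn : 0 ≤ δ₂ := le_trans (by positivity) hδ₂
  have hδ₁le : δ₁ ≤ 1 := by linarith
  have hD0 : 1 - δ₁ - δ₂ ≤ x₁ 0 - y₁ 0 := by rw [hx10, hy10]; linarith
  have hD0' : 0 ≤ 1 - δ₁ - δ₂ := by linarith
  have hD1 : x₁ 0 - y₁ 0 ≤ 1 := by rw [hx10, hy10]; linarith [hyTh0]
  have hvTh_nn : 0 ≤ v Th := le_trans (by
    have : 0 ≤ β * (1 - δ₁) * (h - u 0) / e := by
      have : 0 ≤ 1 - δ₁ := by linarith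
      have : 0 ≤ h - u 0 := by linarith
      positivity
    linarith) hvTh
  -- Step 3: capture (sibling lemma) on the shifted system
  have hVabs : gronwallBound |v₁ 0| e' β T ≤ V := by
    refine le_trans (htcTP_gronwallBound_mono ?_) hV
    rw [hv10, abs_of_nonneg hvTh_nn]
    exact hvTh'.trans hVd
  have hm1 : 2 * m + 12 * φ * T ≤ 2 * u₁ 0 ^ 2 := by rw [hu10]; exact hm
  have hL1' : L ^ 2 + 2 * m + 12 * φ * T ≤ (x₁ 0 - y₁ 0) ^ 2 + 2 * u₁ 0 ^ 2 := by
    rw [hu10]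
    have : (1 - δ₁ - δ₂) ^ 2 ≤ (x₁ 0 - y₁ 0) ^ 2 := pow_le_pow_left₀ hD0' hD0 2
    linarith
  have hden : 0 < 2 * e * m - φ := by linarith
  have hTT1 : (x₁ 0 - y₁ 0 + L) / (2 * e * m - φ) ≤ T :=
    le_trans (div_le_div_of_nonneg_right (by linarith) hden.le) hTT
  obtain ⟨hVwin, t₀, ht₀, hcap, -⟩ :=
    heteroclinicTriggerChain_trunc_hop_capture e e' β he he' hβ x₁ u₁ y₁ v₁ hx1 hu1 hy1 hv1 hE1 hT hVabs
      hφ hφm hm1 hL1' hTT1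
  -- the capture time found lies in [0, T]
  have ht₀T : t₀ ≤ T := by
    refine ht₀.2.trans (max_le hT ?_)
    exact hTT1
  -- Step 4: the FIRST capture time
  have hDc : Continuous fun s => x₁ s - y₁ s :=
    (hxc.comp (continuous_id.add continuous_const)).sub (hyc.comp (continuous_id.add continuous_const))
  have hD0L : -L < x₁ 0 - y₁ 0 := by linarith
  obtain ⟨τ, hτ0, hτt₀, hDτ, hDbefore⟩ := htcTP_first_hit hDc hD0L ht₀.1 hcap
  have hτT : τ ≤ T := hτt₀.trans ht₀T
  -- sizes on the transfer window [0, T] of the shifted system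
  have hE1s : ∀ s, x₁ s ^ 2 + u₁ s ^ 2 + y₁ s ^ 2 + v₁ s ^ 2 ≤ 1 := fun s => by
    simp only [hx₁, hu₁, hy₁, hv₁]; exact hEs (s + Th)
  have hφnn : 0 ≤ φ := by
    have hVnn : 0 ≤ V := le_trans (abs_nonneg _) (hVwin 0 ⟨le_rfl, hT⟩)
    rw [hφ]; positivity
  -- (x + y) drifts down by at most φ per unit time
  have hsum : ∀ s, HasDerivAt (fun q => x₁ q + y₁ q + φ * q)
      ((-(e * u₁ s ^ 2) - β * u₁ s * v₁ s) + (e * u₁ s ^ 2 - e' * v₁ s ^ 2) + φ * 1) s := fun s =>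
    ((hx1 s).add (hy1 s)).add ((hasDerivAt_id' s).const_mul φ)
  have hsum' : ∀ s ∈ Icc 0 T,
      0 ≤ (-(e * u₁ s ^ 2) - β * u₁ s * v₁ s) + (e * u₁ s ^ 2 - e' * v₁ s ^ 2) + φ * 1 := by
    intro s hs
    have hvs : |v₁ s| ≤ V := hVwin s hs
    have hus : |u₁ s| ≤ 1 := (sq_le_one_iff_abs_le_one _).1 (by
      linarith [hE1s s, sq_nonneg (x₁ s), sq_nonneg (y₁ s), sq_nonneg (v₁ s)])
    have h1 : β * u₁ s * v₁ s ≤ β * V := by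
      have h2 : u₁ s * v₁ s ≤ |u₁ s| * |v₁ s| := by
        rw [← abs_mul]; exact le_abs_self _
      have h3 : |u₁ s| * |v₁ s| ≤ 1 * V :=
        mul_le_mul hus hvs (abs_nonneg _) zero_le_one
      have h4 := mul_le_mul_of_nonneg_left (h2.trans h3) hβ
      have h5 : β * u₁ s * v₁ s = β * (u₁ s * v₁ s) := by ring
      rw [h5]
      linarith
    have h2 : e' * v₁ s ^ 2 ≤ e' * V ^ 2 := by
      have : v₁ s ^ 2 ≤ V ^ 2 := by
        rw [← sq_abs (v₁ s)]
        exact pow_le_pow_left₀ (abs_nonneg _) hvs 2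
      exact mul_le_mul_of_nonneg_left this he'.le
    have hVnn : 0 ≤ V := (abs_nonneg _).trans hvs
    have h3 : 0 ≤ β * V := mul_nonneg hβ hVnn
    rw [hφ]
    linarith
  have hsumle := htcTP_le_of_deriv_nonneg hsum hsum'
  -- the receiver does not go far below zero on the window
  have hylow : ∀ s, HasDerivAt (fun q => y₁ q + e' * V ^ 2 * q)
      ((e * u₁ s ^ 2 - e' * v₁ s ^ 2) + e' * V ^ 2 * 1) s := fun s =>
    (hy1 s).add ((hasDerivAt_id' s).const_mul _)
  have hylow' : ∀ s ∈ Icc 0 T, 0 ≤ (e * u₁ s ^ 2 - e' * v₁ s ^ 2) + e' * V ^ 2 * 1 := by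
    intro s hs
    have hvs : |v₁ s| ≤ V := hVwin s hs
    have h1 : v₁ s ^ 2 ≤ V ^ 2 := by
      rw [← sq_abs (v₁ s)]
      exact pow_le_pow_left₀ (abs_nonneg _) hvs 2
    have h2 : 0 ≤ e * u₁ s ^ 2 := by positivity
    have h3 := mul_le_mul_of_nonneg_left h1 he'.le
    linarith
  have hylowle := htcTP_le_of_deriv_nonneg hylow hylow'
  have hyge : ∀ s ∈ Icc 0 τ, -(e' * V ^ 2 * T) ≤ y₁ s := by
    intro s hs
    have h1 := hylowle s ⟨hs.1, hs.2.trans hτT⟩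
    simp only [mul_zero, add_zero] at h1
    have h2 : e' * V ^ 2 * s ≤ e' * V ^ 2 * T :=
      mul_le_mul_of_nonneg_left (hs.2.trans hτT) (by positivity)
    rw [hy10] at h1
    linarith [hyTh0]
  -- the carrier stays nonnegative up to the first capture time
  have hxnn : ∀ s ∈ Icc 0 τ, 0 ≤ x₁ s := by
    intro s hs
    have h1 := hsumle s ⟨hs.1, hs.2.trans hτT⟩
    simp only [mul_zero, add_zero] at h1
    rw [hx10, hy10] at h1
    have h2 : -L ≤ x₁ s - y₁ s := by
      rcases hs.2.eq_or_lt with h3 | h3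
      · rw [h3, hDτ]
      · exact (hDbefore s ⟨hs.1, h3⟩).le
    have h3 : φ * s ≤ φ * T := mul_le_mul_of_nonneg_left (hs.2.trans hτT) hφnn
    linarith [hyTh0]
  -- Step 5: the seed survives the transfer
  have hupos : ∀ s, 0 < u s := fun s => by
    rw [heteroclinicTriggerChain_trunc_trigger_formula e e x u y hxc hyc hu s]
    exact mul_pos hu0 (Real.exp_pos _)
  have hy1c : Continuous y₁ := hyc.comp (continuous_id.add continuous_const)
  have hvlow := htcTP_upper_lower_bound (t := τ) (ybar := e' * V ^ 2 * T) he'.le hv1 hy1c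
    (fun s hs => mul_nonneg (mul_nonneg hβ (hxnn s hs)) (hupos _).le) hyge (by rw [hv10]; exact hvTh_nn)
  have hvτ := hvlow τ ⟨hτ0.le, le_rfl⟩
  -- Step 6: assemble, translating back to absolute time
  refine ⟨Th, τ + Th, hTh0, hThmax, by linarith, by linarith, huTh, hbefore, hThlow, hThup, ?_, ?_, ?_, ?_, ?_⟩
  · -- capture
    exact hDτ
  · -- before capture
    intro s hs
    have h1 := hDbefore (s - Th) ⟨by linarith [hs.1], by linarith [hs.2]⟩
    simp only [hx₁, hy₁, sub_add_cancel] at h1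
    exact h1
  · -- receiver content at capture
    have h1 := hsumle τ ⟨hτ0.le, hτT⟩
    simp only [mul_zero, add_zero] at h1
    rw [hx10, hy10] at h1
    have h2 : τ + Th - Th = τ := by ring
    rw [h2]
    have h3 : x₁ τ = y₁ τ - L := by linarith [hDτ]
    show 1 - δ₁ + y 0 + L - φ * τ ≤ 2 * y (τ + Th)
    have h4 : y₁ τ = y (τ + Th) := rfl
    rw [← h4]
    linarith [hyTh0]
  · -- upper trigger on the transfer window
    intro s hs
    have h1 := hVwin (s - Th) ⟨by linarith [hs.1], by linarith [hs.2]⟩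
    simp only [hv₁, sub_add_cancel] at h1
    exact h1
  · -- the seed handed over
    rw [hv10] at hvτ
    have h1 : Real.exp (-((e' * V) ^ 2 * T * T)) ≤ Real.exp (-(e' * (e' * V ^ 2 * T) * τ)) := by
      rw [Real.exp_le_exp, neg_le_neg_iff]
      have h2 : e' * (e' * V ^ 2 * T) * τ = (e' * V) ^ 2 * T * τ := by ring
      rw [h2]
      exact mul_le_mul_of_nonneg_left hτT (by positivity)
    have h2 : 0 ≤ v 0 + β * (1 - δ₁) * (h - u 0) / e := by
      have : 0 ≤ 1 - δ₁ := by linarith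
      have : 0 ≤ h - u 0 := by linarith
      positivity
    calc (v 0 + β * (1 - δ₁) * (h - u 0) / e) * Real.exp (-((e' * V) ^ 2 * T * T))
        ≤ v Th * Real.exp (-(e' * (e' * V ^ 2 * T) * τ)) :=
          mul_le_mul hvTh h1 (Real.exp_pos _).le hvTh_nn
      _ ≤ v₁ τ := hvτ
      _ = v (τ + Th) := rfl

end Summit.NavierStokesRegularity.NavierStokesRegularity.Theorems

end
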